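import Literature.Geometry.Lorentzian.CauchyProblemMGHDExistence
import Literature.Geometry.Lorentzian.CauchyProblemCauchy
import HarnessLib

/-!
# Isometry classes of Cauchy developments, maximality along extensions, and the
# common-extension corollary of MGHD existence (Sbierski 2016, §2 — the soft part, proved)

Companion of `CauchyProblemMGHDExistence` (the named fact
`choquetBruhat_geroch_exists_mghd_cauchy`: Choquet-Bruhat–Geroch, Comm. Math. Phys. 14 (1969),
Thm. 3; Sbierski, Ann. Henri Poincaré 17 (2016) 301–329 = arXiv:1309.7591, §2, Theorem "Existence
of MGHD"), of `CauchyProblemCauchy` (composition of embeddings; uniqueness of the MGHD given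
rigidity) and of `CauchyProblemMGHDExistenceProofs` (the order-theoretic Zorn frame of the
printed 1969 proof). Sbierski's proof (§2–§3) runs: local existence and existence of a common
globally hyperbolic development (CGHD) for any two GHDs (Theorem "local existence and
uniqueness", Choquet-Bruhat 1952) → isometric immersions with equal 1-jet at a point agree (first
lemma of §3, via geodesics) → maximal CGHD and the Hausdorff gluing of two GHDs (§3.1–3.2) →
gluing of a set of representatives of all GHDs and maximality via the flow of a timelike vector
field (§3.3). The hyperbolic PDE theory, the geodesic rigidity and the quotient-manifold gluing
have no carrier in Mathlib or `Literature` at the pin (module docstring of `CauchyProblem`,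
§ Verdict clean-up), so the fact itself stays a cited named fact. This file proves the part of
§2 that the prelude carries and that §3 uses at every step ("we can isometrically embed `U` into
`M` by using the isometric embedding that is provided by `M` being an extension of `U`", Remark
(2) after the definition of a CGHD; "pulling back the Lorentzian metric, we obtain that there is
an `M_α ∈ X` that is isometric to `M`", §3.3):

* `TimeOrientation.PreservesTimeOrientation.isFutureDirected_of_mfderiv` — for a time-orientation
  preserving isometric immersion `φ`, a vector whose image `dφ v` is future-directed is itself
  future-directed (converse of `isFutureDirected_mfderiv`, `ConvergenceTransport`; O'Neill 1983,
  Ch. 5, p. 145);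
* `DataEmbedding.IsIsometricTo.refl/symm/trans`, `DataEmbedding.IsIsometricTo.equivalence` (and
  the `CauchyDevelopment` aliases) — **"isometric as developments" is an equivalence relation**
  (Sbierski 2016, §2, Remark (1) after the definition of a CGHD: "one should actually consider the
  isometry class of a GHD to be the solution"); the inverse of a time-orientation preserving
  isometric diffeomorphism commuting with the data embeddings is again one (chain rule for
  pullbacks, and the converse timecone lemma);
* `DataEmbedding.IsIsometricTo.embedsInto_congr_left/right`, `….embedsInto_symm` — **the
  extension relation descends to isometry classes** (ibid.: "the Definitions (extension) and
  (CGHD) also descend to the isometry classes of GHDs");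
* `VacuumCauchyDevelopment.IsMaximal.of_embedsInto`, `….of_isIsometricTo`, `isMaximal_congr`,
  `IsMaximal.embedsInto_iff` — **an extension of a maximal vacuum Cauchy development is maximal,
  and the extensions of a maximal development are exactly the maximal ones** (Choquet-Bruhat–Geroch
  1969, p. 332; Sbierski 2016, end of §3.3: "it is straightforward to deduce from this maximality
  property that M̃ is, up to isometry, the only GHD with this property"), and
  `IsMaximal.isIsometricTo_of_embedsInto` (given rigidity, every extension of a maximal
  development is isometric to it, by `VacuumCauchyDevelopment.isIsometricTo_of_isMaximal`);
* `choquetBruhat_geroch_exists_mghd_cauchy.exists_common_extension`,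
  `….exists_isMaximal_extension`, `….embedsInto_and_embedsInto_of_isMaximal` — under the named
  fact, **any two vacuum Cauchy developments of the same data have a common extension** (Sbierski
  2016, §2, Theorem "Global uniqueness": "Given two GHDs `M` and `M'` of the same initial data,
  there exists a GHD `M̃` that is an extension of `M` and `M'`"; "Theorem (MGHD) clearly implies
  Theorem (CommonExtension)"), every development extends to a maximal one, and maximal ones
  embed into each other.

Nothing here is deep and no named fact is introduced (D-0026); the named fact
`choquetBruhat_geroch_exists_mghd_cauchy` is consumed only as an explicit hypothesis `(h : …)` of
the corollaries in its namespace.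

## References

* Y. Choquet-Bruhat, R. Geroch, *Global aspects of the Cauchy problem in general relativity*,
  Comm. Math. Phys. 14 (1969) 329–335, Thm. 3 (p. 332) and its proof (pp. 332–334).
* J. Sbierski, *On the existence of a maximal Cauchy development for the Einstein equations: a
  dezornification*, Ann. Henri Poincaré 17 (2016) 301–329 = arXiv:1309.7591, §2 (Definitions of
  GHD, extension, CGHD; Remark on isometry classes; Theorems "local existence and uniqueness",
  "Global uniqueness", "Existence of MGHD"), §3.3 (end).
* B. O'Neill, *Semi-Riemannian geometry with applications to relativity*, Academic Press 1983,
  Ch. 3, p. 58 (pullbacks compose, inverse of an isometry); Ch. 5, Lemma 5.29 and p. 145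
  (timecones, time orientation).
* H. Ringström, *The Cauchy Problem in General Relativity*, EMS 2009, Def. 16.5, Thm. 16.6.
-/

noncomputable section

open Function Set
open scoped Manifold ContDiff Topology

namespace Literature.Geometry.Lorentzian

universe u

/-! ### The timecone lemma, converse direction -/

section Generic

variable {E : Type*} [NormedAddCommGroup E] [NormedSpace ℝ E] {H : Type*} [TopologicalSpace H]
  {I : ModelWithCorners ℝ E H} {n : ℕ∞ω} {M : Type*} [TopologicalSpace M] [ChartedSpace H M]
  [IsManifold I ∞ M]
  {E' : Type*} [NormedAddCommGroup E'] [NormedSpace ℝ E'] {H' : Type*} [TopologicalSpace H']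
  {I' : ModelWithCorners ℝ E' H'} {N : Type*} [TopologicalSpace N] [ChartedSpace H' N]
  [IsManifold I' ∞ N]

namespace TimeOrientation

variable {g : LorentzianMetric I n M} {τ : TimeOrientation g}
  {gN : LorentzianMetric I' n N} {τN : TimeOrientation gN}

/-- **Converse timecone lemma for time-orientation preserving isometric immersions.** Let
`φ : N → M` satisfy `φ^* g = g_N` and send the orienting field of `N` into the future cone of `M`
(`PreservesTimeOrientation`). If `dφ_y v` is future-directed in `M`, then `v` is future-directed
in `N`: `v` is causal because `dφ_y` preserves scalar products and is injective, and if `v` were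
past-directed then `dφ_y (−v) = −dφ_y v` would be future-directed
(`PreservesTimeOrientation.isFutureDirected_mfderiv`), contradicting that no vector is both
future- and past-directed. O'Neill 1983, Ch. 5, Lemma 5.29 ff. and p. 145.
[cite: ONeillSemiRiemannian1983, Ch. 5, p. 145] -/
theorem PreservesTimeOrientation.isFutureDirected_of_mfderiv {φ : N → M}
    (hτ : τN.PreservesTimeOrientation φ τ)
    (hφ : ∀ y, pullbackBilin (I := I) (I' := I') φ g.val y = gN.val y) {y : N}
    {v : TangentSpace I' y} (hv : τ.IsFutureDirected (mfderiv I' I φ y v)) :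
    τN.IsFutureDirected v := by
  have key : ∀ u w : TangentSpace I' y,
      g.val (φ y) (mfderiv I' I φ y u) (mfderiv I' I φ y w) = gN.val y u w := fun u w ↦ by
    have h := congrArg (fun b ↦ b u w) (hφ y)
    simpa only [pullbackBilin_apply] using h
  have hvc : gN.IsCausal v := by
    refine ⟨?_, fun h0 ↦ hv.1.2 ?_⟩
    · rw [← key]
      exact hv.1.1
    · rw [h0, map_zero]
  rcases τN.isFutureDirected_or_isPastDirected_of_isCausal hvc with h | h
  · exact h
  · exfalso
    have h' := hτ.isFutureDirected_mfderiv hφ ((τN.isFutureDirected_neg_iff v).mpr h)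
    rw [map_neg, TimeOrientation.isFutureDirected_neg_iff] at h'
    exact τ.not_isPastDirected_of_isFutureDirected hv h'

end TimeOrientation

end Generic

/-! ### Isometry classes of data embeddings (Sbierski 2016, §2, Remark) -/

section DataEmbedding

variable {n : ℕ} {X' : Type u} [TopologicalSpace X'] [ChartedSpace (EuclideanSpace ℝ (Fin n)) X']
  [IsManifold (𝓡 n) ∞ X'] [ConnectedSpace X'] {D : InitialDataSet (𝓡 n) X'}

namespace DataEmbedding

/-- **Every data embedding is isometric to itself** (by the identity diffeomorphism, which is an
isometry, preserves the time orientation and commutes with the data embedding). Sbierski 2016,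
§2, Remark (1) after the definition of a CGHD (isometry classes of GHDs); O'Neill 1983, Ch. 3,
p. 58. [cite: Sbierski2016AHP, §2, Remark (1) after the definition of a CGHD] -/
theorem IsIsometricTo.refl (𝒮 : DataEmbedding D) : 𝒮.IsIsometricTo 𝒮 := by
  refine ⟨Diffeomorph.refl (𝓡 (n + 1)) 𝒮.carrier ∞,
    PseudoRiemannianMetric.isIsometry_refl 𝒮.metric.toPseudoRiemannianMetric, fun y ↦ ?_, ?_⟩
  · rw [Diffeomorph.coe_refl, mfderiv_id]
    exact 𝒮.timeOrientation.isFutureDirected_vectorField y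
  · rw [Diffeomorph.coe_refl]
    rfl

/-- **"Isometric as developments" is symmetric**: if `ψ : M₁ ≃ M₂` is a time-orientation
preserving isometry with `ψ ∘ ι₁ = ι₂`, then `ψ⁻¹` is a time-orientation preserving isometry with
`ψ⁻¹ ∘ ι₂ = ι₁`. The inverse is an isometry by the chain rule for pullbacks
(`(ψ⁻¹)^* g₁ = (ψ⁻¹)^* ψ^* g₂ = (ψ ∘ ψ⁻¹)^* g₂ = g₂`, O'Neill 1983, Ch. 3, p. 58); it preserves the
time orientation because `dψ (dψ⁻¹ T₂) = T₂` is future-directed and `dψ` reflects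
future-directedness (`PreservesTimeOrientation.isFutureDirected_of_mfderiv`, O'Neill 1983, Ch. 5,
p. 145). Sbierski 2016, §2, Remark (1) after the definition of a CGHD.
[cite: Sbierski2016AHP, §2, Remark (1) after the definition of a CGHD] -/
theorem IsIsometricTo.symm {𝒮₁ 𝒮₂ : DataEmbedding D} (h : 𝒮₁.IsIsometricTo 𝒮₂) :
    𝒮₂.IsIsometricTo 𝒮₁ := by
  obtain ⟨ψ, hiso, hτ, hι⟩ := h
  have hψd : MDifferentiable (𝓡 (n + 1)) (𝓡 (n + 1)) ψ := ψ.contMDiff.mdifferentiable (by simp)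
  have hψsd : MDifferentiable (𝓡 (n + 1)) (𝓡 (n + 1)) ψ.symm :=
    ψ.symm.contMDiff.mdifferentiable (by simp)
  have hid : (ψ : 𝒮₁.carrier → 𝒮₂.carrier) ∘ ψ.symm = id := funext ψ.apply_symm_apply
  -- the inverse diffeomorphism is an isometry
  have hiso' : 𝒮₂.metric.IsIsometry 𝒮₁.metric.toPseudoRiemannianMetric ψ.symm := by
    intro z
    have h1 : 𝒮₁.metric.val =
        pullbackBilin (I := 𝓡 (n + 1)) (I' := 𝓡 (n + 1)) ψ 𝒮₂.metric.val :=
      (funext hiso).symm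
    rw [h1, ← pullbackBilin_comp hψd hψsd, hid, pullbackBilin_id]
  -- `dψ ∘ dψ⁻¹ = id`
  have hkey : ∀ (z : 𝒮₂.carrier) (w : TangentSpace (𝓡 (n + 1)) z),
      mfderiv (𝓡 (n + 1)) (𝓡 (n + 1)) ψ (ψ.symm z)
        (mfderiv (𝓡 (n + 1)) (𝓡 (n + 1)) ψ.symm z w) = w := by
    intro z w
    have h := mfderiv_comp z (hψd (ψ.symm z)) (hψsd z)
    rw [hid, mfderiv_id] at h
    exact (congrArg (fun L ↦ L w) h).symm
  refine ⟨ψ.symm, hiso', fun z ↦ ?_, ?_⟩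
  · -- the inverse preserves the time orientation
    refine hτ.isFutureDirected_of_mfderiv hiso ?_
    rw [hkey, ψ.apply_symm_apply]
    exact 𝒮₂.timeOrientation.isFutureDirected_vectorField z
  · -- the inverse commutes with the data embeddings
    rw [← hι]
    funext x
    simp

/-- **"Isometric as developments" is transitive**: composites of time-orientation preserving
isometries commuting with the data embeddings are such (chain rule for pullbacks,
`pullbackBilin_comp`; `PreservesTimeOrientation.comp`). Sbierski 2016, §2, Remark (1) after the
definition of a CGHD; O'Neill 1983, Ch. 3, p. 58.
[cite: Sbierski2016AHP, §2, Remark (1) after the definition of a CGHD] -/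
theorem IsIsometricTo.trans {𝒮₁ 𝒮₂ 𝒮₃ : DataEmbedding D} (h₁₂ : 𝒮₁.IsIsometricTo 𝒮₂)
    (h₂₃ : 𝒮₂.IsIsometricTo 𝒮₃) : 𝒮₁.IsIsometricTo 𝒮₃ := by
  obtain ⟨ψ, hψi, hψt, hψc⟩ := h₁₂
  obtain ⟨χ, hχi, hχt, hχc⟩ := h₂₃
  have hψd : MDifferentiable (𝓡 (n + 1)) (𝓡 (n + 1)) ψ := ψ.contMDiff.mdifferentiable (by simp)
  have hχd : MDifferentiable (𝓡 (n + 1)) (𝓡 (n + 1)) χ := χ.contMDiff.mdifferentiable (by simp)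
  refine ⟨ψ.trans χ, fun y ↦ ?_, ?_, ?_⟩
  · rw [Diffeomorph.coe_trans, pullbackBilin_comp hχd hψd,
      show pullbackBilin (I := 𝓡 (n + 1)) (I' := 𝓡 (n + 1)) χ 𝒮₃.metric.val = 𝒮₂.metric.val from
        funext hχi]
    exact hψi y
  · rw [Diffeomorph.coe_trans]
    exact hχt.comp hψt hχi hχd hψd
  · rw [Diffeomorph.coe_trans, comp_assoc, hψc, hχc]

/-- `𝒮₁` is isometric to `𝒮₂` iff `𝒮₂` is isometric to `𝒮₁`. Sbierski 2016, §2, Remark (1) after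
the definition of a CGHD. [cite: Sbierski2016AHP, §2, Remark (1) after the definition of a CGHD] -/
theorem isIsometricTo_comm {𝒮₁ 𝒮₂ : DataEmbedding D} : 𝒮₁.IsIsometricTo 𝒮₂ ↔ 𝒮₂.IsIsometricTo 𝒮₁ :=
  ⟨IsIsometricTo.symm, IsIsometricTo.symm⟩

/-- **Isometry of developments is an equivalence relation** on the data embeddings of a fixed
initial data set — the "isometry classes of GHDs" of Sbierski 2016, §2, Remark (1) after the
definition of a CGHD ("one should actually consider the isometry class of a GHD to be the solution
to the Einstein equations"). [cite: Sbierski2016AHP, §2, Remark (1) after the definition of a CGHD] -/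
theorem IsIsometricTo.equivalence : Equivalence (IsIsometricTo (D := D)) :=
  ⟨IsIsometricTo.refl, IsIsometricTo.symm, IsIsometricTo.trans⟩

/-- **The extension relation descends to isometry classes (source side)**: isometric data
embeddings embed into the same data embeddings. Sbierski 2016, §2, Remark (1) after the
definition of a CGHD ("the Definitions (extension) and (CGHD) also descend to the isometry
classes of GHDs"). [cite: Sbierski2016AHP, §2, Remark (1) after the definition of a CGHD] -/
theorem IsIsometricTo.embedsInto_congr_left {𝒮₁ 𝒮₂ : DataEmbedding D} (h : 𝒮₁.IsIsometricTo 𝒮₂)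
    (𝒮₃ : DataEmbedding D) : 𝒮₁.EmbedsInto 𝒮₃ ↔ 𝒮₂.EmbedsInto 𝒮₃ :=
  ⟨fun h' ↦ h.symm.embedsInto.trans h', fun h' ↦ h.embedsInto.trans h'⟩

/-- **The extension relation descends to isometry classes (target side)**: a data embedding
embeds into `𝒮₂` iff it embeds into any data embedding isometric to `𝒮₂`. Sbierski 2016, §2,
Remark (1)–(2) after the definition of a CGHD. [cite: Sbierski2016AHP, §2, Remark (1) after the definition of a CGHD] -/
theorem IsIsometricTo.embedsInto_congr_right {𝒮₂ 𝒮₃ : DataEmbedding D} (h : 𝒮₂.IsIsometricTo 𝒮₃)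
    (𝒮₁ : DataEmbedding D) : 𝒮₁.EmbedsInto 𝒮₂ ↔ 𝒮₁.EmbedsInto 𝒮₃ :=
  ⟨fun h' ↦ h'.trans h.embedsInto, fun h' ↦ h'.trans h.symm.embedsInto⟩

/-- Isometric data embeddings embed into each other. Sbierski 2016, §2, Remark (2) after the
definition of a CGHD; Ringström 2009, Def. 16.5. [cite: Sbierski2016AHP, §2, Remark (2) after the definition of a CGHD] -/
theorem IsIsometricTo.embedsInto_symm {𝒮₁ 𝒮₂ : DataEmbedding D} (h : 𝒮₁.IsIsometricTo 𝒮₂) :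
    𝒮₂.EmbedsInto 𝒮₁ :=
  h.symm.embedsInto

end DataEmbedding

namespace CauchyDevelopment

/-- Every Cauchy development is isometric to itself (`DataEmbedding.IsIsometricTo.refl`).
Sbierski 2016, §2, Remark (1) after the definition of a CGHD. [cite: Sbierski2016AHP, §2, Remark (1) after the definition of a CGHD] -/
theorem IsIsometricTo.refl (𝒟 : CauchyDevelopment D) : 𝒟.IsIsometricTo 𝒟 :=
  DataEmbedding.IsIsometricTo.refl _

/-- Isometry of Cauchy developments is symmetric (`DataEmbedding.IsIsometricTo.symm`).
Sbierski 2016, §2, Remark (1) after the definition of a CGHD. [cite: Sbierski2016AHP, §2, Remark (1) after the definition of a CGHD] -/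
theorem IsIsometricTo.symm {𝒟₁ 𝒟₂ : CauchyDevelopment D} (h : 𝒟₁.IsIsometricTo 𝒟₂) :
    𝒟₂.IsIsometricTo 𝒟₁ :=
  DataEmbedding.IsIsometricTo.symm h

/-- Isometry of Cauchy developments is transitive (`DataEmbedding.IsIsometricTo.trans`).
Sbierski 2016, §2, Remark (1) after the definition of a CGHD. [cite: Sbierski2016AHP, §2, Remark (1) after the definition of a CGHD] -/
theorem IsIsometricTo.trans {𝒟₁ 𝒟₂ 𝒟₃ : CauchyDevelopment D} (h₁₂ : 𝒟₁.IsIsometricTo 𝒟₂)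
    (h₂₃ : 𝒟₂.IsIsometricTo 𝒟₃) : 𝒟₁.IsIsometricTo 𝒟₃ :=
  DataEmbedding.IsIsometricTo.trans h₁₂ h₂₃

end CauchyDevelopment

/-! ### Maximality along extensions and isometries -/

namespace VacuumCauchyDevelopment

/-- **An extension of a maximal vacuum Cauchy development is maximal**: if every vacuum Cauchy
development embeds into `𝒟` and `𝒟` embeds into `𝒟'`, then every vacuum Cauchy development
embeds into `𝒟'` (embeddings compose, `CauchyDevelopment.EmbedsInto.trans`). This is the order
theory behind "the MGHD is an extension of every GHD and is unique up to isometry"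
(Choquet-Bruhat–Geroch 1969, Thm. 3, p. 332; Sbierski 2016, end of §3.3).
[cite: ChoquetBruhatGeroch1969CMP, Thm. 3 (p. 332)] -/
theorem IsMaximal.of_embedsInto {𝒟 𝒟' : VacuumCauchyDevelopment D} (h : 𝒟.IsMaximal)
    (h' : 𝒟.toCauchyDevelopment.EmbedsInto 𝒟'.toCauchyDevelopment) : 𝒟'.IsMaximal :=
  fun 𝒟'' ↦ (h 𝒟'').trans h'

/-- **Maximality descends to isometry classes**: a vacuum Cauchy development isometric to a
maximal one is maximal. Sbierski 2016, §2, Remark (1) after the definition of a CGHD, with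
Theorem "Existence of MGHD" ("unique up to isometry").
[cite: Sbierski2016AHP, §2, Remark (1) after the definition of a CGHD] -/
theorem IsMaximal.of_isIsometricTo {𝒟 𝒟' : VacuumCauchyDevelopment D} (h : 𝒟.IsMaximal)
    (h' : 𝒟.toCauchyDevelopment.IsIsometricTo 𝒟'.toCauchyDevelopment) : 𝒟'.IsMaximal :=
  h.of_embedsInto h'.embedsInto

/-- Isometric vacuum Cauchy developments are simultaneously maximal or not. Sbierski 2016, §2,
Remark (1) after the definition of a CGHD. [cite: Sbierski2016AHP, §2, Remark (1) after the definition of a CGHD] -/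
theorem isMaximal_congr {𝒟 𝒟' : VacuumCauchyDevelopment D}
    (h' : 𝒟.toCauchyDevelopment.IsIsometricTo 𝒟'.toCauchyDevelopment) :
    𝒟.IsMaximal ↔ 𝒟'.IsMaximal :=
  ⟨fun h ↦ h.of_isIsometricTo h', fun h ↦ h.of_isIsometricTo h'.symm⟩

/-- **The extensions of a maximal vacuum Cauchy development are exactly the maximal ones**: for
maximal `𝒟`, `𝒟` embeds into `𝒟'` iff `𝒟'` is maximal (`IsMaximal.of_embedsInto`, and a maximal
`𝒟'` receives an embedding of every development, in particular of `𝒟`). Choquet-Bruhat–Geroch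
1969, Thm. 3 (p. 332); Sbierski 2016, end of §3.3 ("M̃ is, up to isometry, the only GHD with this
property"). [cite: ChoquetBruhatGeroch1969CMP, Thm. 3 (p. 332)] -/
theorem IsMaximal.embedsInto_iff {𝒟 𝒟' : VacuumCauchyDevelopment D} (h : 𝒟.IsMaximal) :
    𝒟.toCauchyDevelopment.EmbedsInto 𝒟'.toCauchyDevelopment ↔ 𝒟'.IsMaximal :=
  ⟨fun h' ↦ h.of_embedsInto h', fun h' ↦ h' 𝒟⟩

/-- **Inextendibility of a maximal development within the GHDs, given rigidity**: if `𝒟` is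
maximal and rigid (every time-orientation preserving isometric immersion `φ : M → M` with
`φ ∘ ι = ι` is the identity — the geodesic step of the printed proofs, O'Neill 1983, Ch. 3,
Prop. 3.62, entering as a hypothesis exactly as in
`VacuumCauchyDevelopment.isIsometricTo_of_isMaximal`), then every vacuum Cauchy development
`𝒟'` into which `𝒟` embeds is isometric to `𝒟`: `𝒟'` is maximal by `IsMaximal.of_embedsInto`,
and two maximal developments are isometric given rigidity. Choquet-Bruhat–Geroch 1969, Thm. 3 and
its proof (pp. 332–334); Sbierski 2016, end of §3.3.
[cite: ChoquetBruhatGeroch1969CMP, Thm. 3 (pp. 332–334)] -/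
theorem IsMaximal.isIsometricTo_of_embedsInto {𝒟 𝒟' : VacuumCauchyDevelopment D}
    (hrig : ∀ φ : 𝒟.carrier → 𝒟.carrier,
      𝒟.metric.IsIsometricImmersion 𝒟.metric.toPseudoRiemannianMetric φ →
        𝒟.timeOrientation.PreservesTimeOrientation φ 𝒟.timeOrientation →
          φ ∘ 𝒟.embed = 𝒟.embed → φ = id)
    (h : 𝒟.IsMaximal) (h' : 𝒟.toCauchyDevelopment.EmbedsInto 𝒟'.toCauchyDevelopment) :
    𝒟.toCauchyDevelopment.IsIsometricTo 𝒟'.toCauchyDevelopment :=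
  isIsometricTo_of_isMaximal hrig h (h.of_embedsInto h')

end VacuumCauchyDevelopment

end DataEmbedding

/-! ### Corollaries of the named fact: common extensions (Sbierski 2016, Thm. "Global uniqueness") -/

namespace choquetBruhat_geroch_exists_mghd_cauchy

variable {X : Type} [TopologicalSpace X] [ChartedSpace E3 X] [IsManifold (𝓡 3) ∞ X]
  [T2Space X] [SecondCountableTopology X] [ConnectedSpace X]

/-- **Every vacuum Cauchy development extends to a maximal one**, under
`choquetBruhat_geroch_exists_mghd_cauchy`: the maximal development provided by the fact receives
an embedding of every development of the same data. Choquet-Bruhat–Geroch 1969, Thm. 3 (p. 332: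
"there exists a development M of S which is an extension of every other development of S");
Sbierski 2016, §2, Theorem "Existence of MGHD". [cite: ChoquetBruhatGeroch1969CMP, Thm. 3 (p. 332)] -/
theorem exists_isMaximal_extension (h : choquetBruhat_geroch_exists_mghd_cauchy)
    {D : InitialDataSet (𝓡 3) X} [D.metric.HasLeviCivita] (hD : D.IsVacuumConstraintSolution)
    (𝒟₁ : VacuumCauchyDevelopment D) :
    ∃ 𝒟 : VacuumCauchyDevelopment D,
      𝒟.IsMaximal ∧ 𝒟₁.toCauchyDevelopment.EmbedsInto 𝒟.toCauchyDevelopment :=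
  let ⟨𝒟, h𝒟⟩ := h X D hD
  ⟨𝒟, h𝒟, h𝒟 𝒟₁⟩

/-- **Global uniqueness = existence of a common extension, from MGHD existence** (Sbierski 2016,
§2, Theorem "Global uniqueness": "Given two GHDs `M` and `M'` of the same initial data, there
exists a GHD `M̃` that is an extension of `M` and `M'`", with the remark "Theorem (MGHD) clearly
implies Theorem (CommonExtension)"): under `choquetBruhat_geroch_exists_mghd_cauchy`, any two
vacuum Cauchy developments of a smooth solution of the vacuum constraints embed into a common
(indeed maximal) vacuum Cauchy development. [cite: Sbierski2016AHP, §2, Theorem "Global uniqueness"] -/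
theorem exists_common_extension (h : choquetBruhat_geroch_exists_mghd_cauchy)
    {D : InitialDataSet (𝓡 3) X} [D.metric.HasLeviCivita] (hD : D.IsVacuumConstraintSolution)
    (𝒟₁ 𝒟₂ : VacuumCauchyDevelopment D) :
    ∃ 𝒟 : VacuumCauchyDevelopment D, 𝒟.IsMaximal ∧
      𝒟₁.toCauchyDevelopment.EmbedsInto 𝒟.toCauchyDevelopment ∧
        𝒟₂.toCauchyDevelopment.EmbedsInto 𝒟.toCauchyDevelopment :=
  let ⟨𝒟, h𝒟⟩ := h X D hD
  ⟨𝒟, h𝒟, h𝒟 𝒟₁, h𝒟 𝒟₂⟩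

omit [T2Space X] [SecondCountableTopology X] in
/-- **The maximal development is unique up to mutual embedding**, under
`choquetBruhat_geroch_exists_mghd_cauchy`: any two maximal vacuum Cauchy developments of the same
data embed into each other (each is an extension of every development). With rigidity this is
uniqueness up to isometry (`VacuumCauchyDevelopment.isIsometricTo_of_isMaximal`,
`CauchyProblemCauchy`). Choquet-Bruhat–Geroch 1969, Thm. 3 (p. 332: "This development is unique
(up to isometry)"); Sbierski 2016, §2, Theorem "Existence of MGHD".
[cite: ChoquetBruhatGeroch1969CMP, Thm. 3 (p. 332)] -/
theorem embedsInto_and_embedsInto_of_isMaximal {D : InitialDataSet (𝓡 3) X}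
    {𝒟₁ 𝒟₂ : VacuumCauchyDevelopment D} (h₁ : 𝒟₁.IsMaximal) (h₂ : 𝒟₂.IsMaximal) :
    𝒟₁.toCauchyDevelopment.EmbedsInto 𝒟₂.toCauchyDevelopment ∧
      𝒟₂.toCauchyDevelopment.EmbedsInto 𝒟₁.toCauchyDevelopment :=
  ⟨h₂ 𝒟₁, h₁ 𝒟₂⟩

end choquetBruhat_geroch_exists_mghd_cauchy

end Literature.Geometry.Lorentzian

end
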